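import Summits.QuantumFields.YangMills.Theorems.BalabanUVNodesN08AtRecord13CoP
import Literature.MathematicalPhysics.QuantumFieldTheory.Balaban1983to89.Node00.Record13SepCoP
import Literature.MathematicalPhysics.QuantumFieldTheory.Balaban1983to89.Node00.Record13CarriersSepCoP

/-!
# v1.5 `CoP` EDITION — director-ym LINE №160 ∕ №162 ((y) FINAL, EDITION FREEZE): RECORD 13 re-seeded at print's COLLAR-ranged background class (node00-def-R FILE 22′
# `LargeFieldBackgroundCoPOfRecord`, `UbgMSCoPOfRecord`) and the collar-exempt 𝐓-weights (def-T 12a″); def-T FILE 23 `Node00/Record13CoP` (p520810) + 24T `Node00/Record13SepCoP`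
# (p521293), token tables KEY-23 ∕ KEY-24T = «the v1.4 names with `Co ↦ CoP`» (`toStage5₁₃CoP`, `datumOfRecord₁₃CoP`, `IsRecordOfRecord₁₃CCoP`, `Provisos₁₃SepCoP`, `datumOfRecord₁₃SepCoP`,
# `IsRecordOfRecord₁₃CSepCoP(.toCoP)`; `Provisos₁₃Core` token-identical), dag-n10-d's CoP carrier leaves `Node00/Record13CarriersCoP ∕ Record13CarriersSepCoP` (`toStage5₁₃CoP_pin<G> ∕ _rebindX`,
# `view₁₃CoPB10YZW(_eq)`, `datumOfRecord₁₃(Sep)CoP_pin<G>`, `isRecordOfRecord₁₃C(Sep)CoP_pinB10_of_eq ∕ _rebindX_of_eq`, `exists_world_isRecordOfRecord₁₃CCoP_rebindX`).  THIS FILE is the verbatim token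
# image (of the v1.4 SepCo draft `BalabanUVNodesN08AtRecord13SepCo` (pre-staged f23b918197b5739d, NOT filed at v1.4 per CHOICE-162 — filed ONCE here), itself the image of p514601 `…SepMixed`) under that table (generator `tools/cop_n08_gen.py`); statement SHAPES and proofs identical up to the tokens; the source module stays as the v1.4 sibling.
#
# BalabanUVNodes ∕ N08 AT THE v1.5 STAGE-13 RECORD OF RECORD (separated (7)-regular range, print's background) — the KEY-21T re-key of N08's ₁₃ ∃-currency at
# def-T's FILE 24T `Node00/Record13SepCoP` (p521293: `Stage13Params.Provisos₁₃SepCoP` = the v1.3 rows minus h9 with `bg` AT the Co-class background `UbgOfRecord₁₃CoP`,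
# `datumOfRecord₁₃SepCoP θ h = datumOfRecord₁₃CoP θ h.toCore` (`rfl`), `IsRecordOfRecord₁₃CSepCoP` bound over the CoP view `toStage5₁₃CoP`, `IsRecordOfRecord₁₃CSepCoP.toCoP`;
# director-ym LINE №152 RULING (β), plan rev 20 keys on these names) over dag-n10-d's v1.5 carrier leaf `Node00/Record13CarriersSepCoP` (`Provisos₁₃SepCoP.pin<G>`,
# `datumOfRecord₁₃SepCoP_pin<G>`, `isRecordOfRecord₁₃CSepCoP_pinB10_of_eq`) and this seat's CoP storey `BalabanUVNodesN08AtRecord13CoP` (§1 pointed closers at the CoP view)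
# (Track A, DAG node N08 [Balaban1985UV3] CMP **102** (1985) 255, Thm 1 p. 257 (compact reading) + Thm 2 p. 272; R134 fan-out seat `pub-ymgap-dag-n08-c` g15, strategy s2
# «knit at the record of record», trigger (t19‴) = KEY-21T → KEY-24T; dag-lead ORPHAN-STOREYS row A2 (ONE twin per lineage: the v1.3 text), 2026-08-27)

WHY THIS FILE.  After RULING (β) the items of route «BalabanUVNodes» are re-keyed (plan rev 20) on the v1.5 names: the K0 text reads `θ.Provisos₁₃SepCoP F 2`, the K1 rung 1
reads `IsRecordOfRecord₁₃CSepCoP F 2 (datumOfRecord₁₃SepCoP F 2 θ h) w` AND PINS NODE N08 BY NAME as the conjunct `Node00.PrintedUV3V 2 θ.L`.  This seat's v1.2 ∕ v1.3 storeys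
`…N08AtRecord13Sep` (p503348) ∕ `…N08AtRecord13SepMixed` (p514601) are keyed on provisos whose `bg` row and datum read the U_old carrier `UbgOfRecord₁₃` and whose record binds
the world over the U_old view `toStage5₁₃` — NOT instantiable from `h : θ.Provisos₁₃SepCoP F N` (no row map either way; def-T: «NO bridge from or to the U_old provisos»).  So the
∃-CURRENCY — and only it — is re-typed here as the IMAGE of p514601 under def-T's KEY-RULE-21 ∕ KEY-21T ∕ KEY-24T token map `…SepMixed… ↦ …SepCoP…`, `toStage5₁₃ ↦ toStage5₁₃CoP`,
`view₁₃B10YZW ↦ view₁₃CoPB10YZW` (statement SHAPES verbatim, 17 ∕ 17 images; proofs re-checked); the POINTED closers are the CoP storey's §1 (`N08AtRecord13CoP.b10_main_of_up_pinB10 ∕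
_view₁₃CoPB10YZW`, proviso-free), the §0 guards are the CoP storey's §0 along `IsRecordOfRecord₁₃CSepCoP.toCoP` (keyed ONCE on the core, director-ym №152 §4), and the θ-level
guard-per-pin faces are p491313's `N08AtRecord13.guard_pin<G>_iff` (cited).

WHAT IS PROVED (all bookkeeping BY NAME, one `exact`∕`obtain` each):
* §0 the in-edge guards `b4 b5 b6 b7` at every run of every ₁₃CSepCoP record (`.toCoP` + the CoP storey's `guards_of_isRecordOfRecord₁₃CCoP`), hence N08 there reads `b8 → b9 → b11 → b10`;
* §0b the v1.5 record over the [B10]-PINNED and over the FOUR-PIN CoP view at `datumOfRecord₁₃SepCoP θ h` (n10-d's `Provisos₁₃SepCoP.pin<G>`, `datumOfRecord₁₃SepCoP_pin<G>`,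
  `isRecordOfRecord₁₃CSepCoP_pinB10_of_eq`, `view₁₃CoPB10YZW_eq`), and their existence at any window `0 < γw ≤ θ.γ`;
* §2 THE ∃-CURRENCY: from `θ`, `h : θ.Provisos₁₃SepCoP F N`, admissibility and `PrintedUV3V N θ.L` — a world that IS a ₁₃CSepCoP record of `datumOfRecord₁₃SepCoP θ h`, bound over
  the pinned ∕ four-pin CoP view, carrying N08 at every run; the PINNED and FOUR-PIN PRESENTATIONS (same datum, guard and admissibility read AT the presenting parameter, the pin
  returned AT it); and «the K0 antecedent `∃ θ, Provisos₁₃SepCoP ∧ (ZtUnity ∧ SlotsNondegenerate₁₃) ∧ Admissible` + the slot at every odd `L > 1` ⟹ N08's conjunct of rung 1 WITH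
  ITS PIN `PrintedUV3V N θ.L`» (`…_of_inhabited13SepCoP`, `_two` at `N = 2`);
* §3 on the WITNESS LINE OF RECORD `θ₁₃ = theta13LiveOfRecord F N` (θ-level maker, background-free; `L = F.L`, `γ = 1∕2`): N08's share costs `hP : θ₁₃.Provisos₁₃SepCoP F N`
  (HYPOTHESIS, opaque) + `PrintedUV3V N F.L`; guard = K0a's HYPOTHESIS-FREE `ztUnity_theta13LiveOfRecord` ∕ `slotsNondegenerate₁₃_theta13LiveOfRecord_of_hasResiduals`;
* §4 the same at K0a's all-numerics family `theta13LiveOfNumerics n ε₂₉ …` (`γ = n.γ`) and two-letter family `theta13LiveOfFamily₂ ε₀ ε₂₉ …` (`γ = 1∕2`) — θ-level makers,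
  background-free (their `UbgOfRecord₁₃` occurrences in `Record13LiveSelector(Family)` are `hbg` SOCKET hypotheses only) — provisos OPAQUE (`hP : ….Provisos₁₃SepCoP F N`; no
  `bg` socket text here: the CoP socket is node00-def-K0a's 15a ∕ 15b, not this seat's).

HONEST FRAMING.  Count-neutral kernel bookkeeping BY NAME — a re-keying of a LANDED storey to the corrected record (new file; p503348 ∕ p514601 stay as pre-№152 siblings).
NOT A DISCHARGE OF N08: `PrintedUV3V` is TYPED and DISPLAYED as a hypothesis (resp. carried as the pin), NOT PROVED — an inhabitant (the [B10] cluster expansion at print's run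
objects) remains THE object gap; `Provisos₁₃SepCoP`, admissibility and the guard are hypotheses or K0a's theorems, never asserted; K0 ∕ K1 neither proved nor assumed; nothing
of Bałaban's asserted; one finite four-torus per run at fixed `ε`, [B10]'s d = 3 lattices inside the record; nothing continuum ∕ ℝ⁴ ∕ OS ∕ mass gap ∕ Clay.  0 `sorry`, 0 `def`,
standard axioms.  Sources: [Balaban1985UV3] Thm 1 p.257, Thm 2 p.272; [Balaban1989LargeFieldII] Thm 1 + (0.1) pp.355–356; [Balaban1988Convergent] (2.18) p.257, (2.28) p.259,
(3.16)–(3.22) pp.268–269; [Balaban1985Variational] (5)–(7) p.278 (print's background, regular data); [Balaban1985RegularSpaces] (1.3)–(1.9) pp.76–77; [Balaban1987RG1] (0.21) p.256,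
(2.9) p.266.
-/

noncomputable section

namespace Summit.QuantumFields.YangMills.BalabanUVNodes.N08AtRecord13SepCoP

open Literature.MathematicalPhysics.QuantumFieldTheory.Balaban1983to89
open Literature.MathematicalPhysics.QuantumFieldTheory.Balaban1983to89.T4Continuum (T4Family FiniteEpsData)
open Literature.MathematicalPhysics.QuantumFieldTheory.Balaban1983to89.DagBinding
  (WorldP leavesP PrintedCarriersR PrintedCarriers9X PrintedCarriers11 PrintedCarriers15)
open Literature.MathematicalPhysics.QuantumFieldTheory.Balaban1983to89.Node00
open Summit.QuantumFields.YangMills.BalabanUVNodes.N08AtRecord13CoP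
open scoped Matrix.Norms.L2Operator

variable {F : T4Family} {N : ℕ} [NeZero N]

/-! ## §0 THE IN-EDGE GUARDS AT EVERY RUN OF EVERY v1.5 STAGE-13 RECORD — keyed once on the core (`.toCoP`) -/

section Guards
variable {D : FiniteEpsData F (SU N)} {w : WorldP}

/-- **In-edge guards at every run of a ₁₃CSepCoP record**: the leaves `b4`, `b5`, `b6`, `b7` HOLD — N01 ∕ N02 ∕ N03 ∕ N04 are NODE 00 theorems at the Stage-5 shadow
(`Node00.b4∕b5∕b7_main_of_isRecordOfRecord₅C`, `Node00.N03_at_record₅C`), read through `IsRecordOfRecord₁₃CSepCoP.toCoP` from the CoP storey's `N08AtRecord13CoP.guards_of_isRecordOfRecord₁₃CCoP` (FILE 23's `atWorld_of_isRecordOfRecord₁₃CCoP`).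
[cite: Balaban1983RegularityDecay, Theorem p.573; Balaban1984PropagatorsI, Props. 1.1–1.2 pp.33–36; Balaban1984PropagatorsII, Lemma 2.1 – Cor. 2.8 pp.234–249; Balaban1985Averaging, Props. 1–10 pp.26–50 (kernel versions at the objects of record; bookkeeping, transferred)] -/
theorem guards_of_isRecordOfRecord₁₃CSepCoP (h : IsRecordOfRecord₁₃CSepCoP F N D w) (P : B12.RunParams) :
    (leavesP w P).b4 ∧ (leavesP w P).b5 ∧ (leavesP w P).b6 ∧ (leavesP w P).b7 :=
  guards_of_isRecordOfRecord₁₃CCoP h.toCoP P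

/-- Hence at a ₁₃CSepCoP record N08 reads `b8 → b9 → b11 → b10` (the in-edges `b5 b6 b7` drop out). [cite: Balaban1985UV3, Thm 1 p.257, Thm 2 p.272 (bookkeeping)] -/
theorem b10_main_iff_residual_of_isRecordOfRecord₁₃CSepCoP (h : IsRecordOfRecord₁₃CSepCoP F N D w) (P : B12.RunParams) :
    Dag.B10_main (leavesP w P) ↔ ((leavesP w P).b8 → (leavesP w P).b9 → (leavesP w P).b11 → (leavesP w P).b10) :=
  b10_main_iff_residual_of_isRecordOfRecord₁₃CCoP h.toCoP P

end Guards

/-! ## §0b THE v1.5 RECORD OVER THE [B10]-PINNED ∕ FOUR-PIN CoP VIEW, over dag-n10-d's leaf `Node00/Record13CarriersSepCoP` v1.5 twins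
(`Provisos₁₃SepCoP.pin<G>`, `datumOfRecord₁₃SepCoP_pin<G>`, `isRecordOfRecord₁₃CSepCoP_pinB10_of_eq`) BY NAME; the guard and admissibility faces per pin are θ-level
(p491313 §0b `guard_pin<G>_iff`, n10-d `Stage13Params.pin<G>_admissible_iff`, all `Iff.rfl`) and serve verbatim -/

section PinFaces
variable (θ : Stage13Params F N)

/-- **EVERY admissible Stage-13 parameter with v1.5 provisos presents a ₁₃CSepCoP record at its own datum whose world is bound over the [B10]-PINNED CoP view**,
any window `0 < γw ≤ θ.γ`, block size `θ.L` (def-T's world construction at `θ.pinB10`, through n10-d's `isRecordOfRecord₁₃CSepCoP_pinB10_of_eq`). [cite: Balaban1989LargeFieldII, Thm 1 + (0.1) pp.355–356 (bookkeeping)] -/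
theorem exists_world_isRecordOfRecord₁₃CSepCoP_pinB10 (h : θ.Provisos₁₃SepCoP F N) (hθ : θ.Admissible F N) {γw : ℝ} (hγw : 0 < γw ∧ γw ≤ θ.γ) :
    ∃ w : WorldP, IsRecordOfRecord₁₃CSepCoP F N (datumOfRecord₁₃SepCoP F N θ h) w ∧ w.γ = γw ∧ w.L = (θ.L : ℝ) ∧
      ∀ P, w.up P = upOfRecord₅C F N ((θ.pinB10 F N).toStage5₁₃CoP F N) P := by
  obtain ⟨w₀⟩ := nonempty_worldP
  exact ⟨{ w₀ with
      C := (datumOfRecord₁₃SepCoP F N θ h).C, γ := γw, L := (θ.L : ℝ), one_lt_L := by exact_mod_cast θ.hL.2,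
      up := fun P => upOfRecord₅C F N ((θ.pinB10 F N).toStage5₁₃CoP F N) P },
    isRecordOfRecord₁₃CSepCoP_pinB10_of_eq F N θ h hθ _ rfl hγw rfl (fun _ => rfl), rfl, rfl, fun _ => rfl⟩

/-- **A world with def-T's pointed clauses bound over n10-d's FOUR-PIN Stage-13 view IS a ₁₃CSepCoP record AT `datumOfRecord₁₃SepCoP θ h`** (presenting parameter the quadruply
pinned `θ`; v1.5 provisos transported pin by pin, datum by the four `rfl`s, view by `view₁₃CoPB10YZW_eq` — p514601 §0b re-keyed).
[cite: Balaban1989LargeFieldII, Thm 1 + (0.1) pp.355–356 (bookkeeping)] -/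
theorem isRecordOfRecord₁₃CSepCoP_view₁₃CoPB10YZW_of_eq (h : θ.Provisos₁₃SepCoP F N) (hθ : θ.Admissible F N) (Mstar : ℕ) (ops : OpsY N θ.toStage3Params Mstar)
    (ζ : ResidZ F N) (lamW : ResidW F N) (w : WorldP) (hC : w.C = (datumOfRecord₁₃SepCoP F N θ h).C) (hγ : 0 < w.γ ∧ w.γ ≤ θ.γ) (hL : w.L = (θ.L : ℝ))
    (hup : ∀ P, w.up P = upOfRecord₅C F N (θ.view₁₃CoPB10YZW F N Mstar ops ζ lamW) P) :
    IsRecordOfRecord₁₃CSepCoP F N (datumOfRecord₁₃SepCoP F N θ h) w := by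
  have h₁ : (θ.pinB10 F N).Provisos₁₃SepCoP F N := h.pinB10
  have h₂ : ((θ.pinB10 F N).pinY F N (Y9OfRecord N θ.toStage3Params Mstar ops)).Provisos₁₃SepCoP F N := h₁.pinY _
  have h₃ : (((θ.pinB10 F N).pinY F N (Y9OfRecord N θ.toStage3Params Mstar ops)).pinZ F N (Z11OfRecord F N ζ)).Provisos₁₃SepCoP F N := h₂.pinZ _
  have h₄ : ((((θ.pinB10 F N).pinY F N (Y9OfRecord N θ.toStage3Params Mstar ops)).pinZ F N (Z11OfRecord F N ζ)).pinW F N (WOfRecord₁₃ F N θ lamW)).Provisos₁₃SepCoP F N :=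
    h₃.pinW _
  have hθ' : ((((θ.pinB10 F N).pinY F N (Y9OfRecord N θ.toStage3Params Mstar ops)).pinZ F N (Z11OfRecord F N ζ)).pinW F N (WOfRecord₁₃ F N θ lamW)).Admissible F N :=
    (Stage13Params.pinW_admissible_iff F N _ _).2 ((Stage13Params.pinZ_admissible_iff F N _ _).2
      ((Stage13Params.pinY_admissible_iff F N _ _).2 ((Stage13Params.pinB10_admissible_iff F N _).2 hθ)))
  refine ⟨_, h₄, hθ', ?_, hC, hγ, hL, fun P => ?_⟩
  · rw [datumOfRecord₁₃SepCoP_pinW F N _ h₃, datumOfRecord₁₃SepCoP_pinZ F N _ h₂, datumOfRecord₁₃SepCoP_pinY F N _ h₁, datumOfRecord₁₃SepCoP_pinB10 F N θ h]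
  · rw [hup P, Stage13Params.view₁₃CoPB10YZW_eq]

/-- … hence EVERY admissible Stage-13 parameter with v1.5 provisos presents a ₁₃CSepCoP record at its own datum whose world is bound over the FOUR-PIN CoP view
(package EXPOSED: any floor `Mstar`, operator layer `ops`, [B11] layer `ζ`, [IV] layer `lamW`), any window, block size `θ.L`. [cite: Balaban1989LargeFieldII, Thm 1 + (0.1) pp.355–356 (bookkeeping)] -/
theorem exists_world_isRecordOfRecord₁₃CSepCoP_view₁₃CoPB10YZW (h : θ.Provisos₁₃SepCoP F N) (hθ : θ.Admissible F N) (Mstar : ℕ) (ops : OpsY N θ.toStage3Params Mstar)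
    (ζ : ResidZ F N) (lamW : ResidW F N) {γw : ℝ} (hγw : 0 < γw ∧ γw ≤ θ.γ) :
    ∃ w : WorldP, IsRecordOfRecord₁₃CSepCoP F N (datumOfRecord₁₃SepCoP F N θ h) w ∧ w.γ = γw ∧ w.L = (θ.L : ℝ) ∧
      ∀ P, w.up P = upOfRecord₅C F N (θ.view₁₃CoPB10YZW F N Mstar ops ζ lamW) P := by
  obtain ⟨w₀⟩ := nonempty_worldP
  exact ⟨{ w₀ with
      C := (datumOfRecord₁₃SepCoP F N θ h).C, γ := γw, L := (θ.L : ℝ), one_lt_L := by exact_mod_cast θ.hL.2,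
      up := fun P => upOfRecord₅C F N (θ.view₁₃CoPB10YZW F N Mstar ops ζ lamW) P },
    isRecordOfRecord₁₃CSepCoP_view₁₃CoPB10YZW_of_eq θ h hθ Mstar ops ζ lamW _ rfl hγw rfl (fun _ => rfl), rfl, rfl, fun _ => rfl⟩

end PinFaces

/-! ## §2 THE ∃-CURRENCY OF THE rev-20 NODES STUB — N08's conjunct at the v1.5 record, the guard riding on `θ`, and the rung-1 PIN `PrintedUV3V N θ.L` -/

section Currency

/-- **AT THE DATUM OF ANY ADMISSIBLE STAGE-13 TUPLE WITH v1.5 PROVISOS, a world (any window height `γw`, block size `θ.L`) that IS a ₁₃CSepCoP record of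
`datumOfRecord₁₃SepCoP F N θ h`, bound over the [B10]-PINNED CoP view, carrying N08 at every run — from the one slot instance `PrintedUV3V N θ.L`** (§0b + the CoP storey's
proviso-free pointed closer `N08AtRecord13CoP.b10_main_of_up_pinB10`). [cite: Balaban1985UV3, Thm 1 p.257, Thm 2 p.272; Balaban1989LargeFieldII, Thm 1 + (0.1) pp.355–356 (the record's world; bookkeeping)] -/
theorem exists_world₁₃CSepCoP_b10_main_of_slot (θ : Stage13Params F N) (h : θ.Provisos₁₃SepCoP F N) (hθ : θ.Admissible F N) {γw : ℝ} (hγw : 0 < γw ∧ γw ≤ θ.γ)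
    (hUV : PrintedUV3V N θ.L) :
    ∃ w : WorldP, IsRecordOfRecord₁₃CSepCoP F N (datumOfRecord₁₃SepCoP F N θ h) w ∧ w.γ = γw ∧ w.L = (θ.L : ℝ) ∧
      (∀ P, w.up P = upOfRecord₅C F N ((θ.pinB10 F N).toStage5₁₃CoP F N) P) ∧ ∀ P : B12.RunParams, Dag.B10_main (leavesP w P) := by
  obtain ⟨w, hR, hγ, hL, hup⟩ := exists_world_isRecordOfRecord₁₃CSepCoP_pinB10 θ h hθ hγw
  exact ⟨w, hR, hγ, hL, hup, b10_main_of_up_pinB10 θ hup hUV⟩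

/-- **The four-pin twin** (package EXPOSED): at the same datum a world bound over `θ.view₁₃CoPB10YZW Mstar ops ζ lamW` that IS a ₁₃CSepCoP record and carries N08 at every run,
from `PrintedUV3V N θ.L` — the world at which the other nodes' pointed closers over the four-pin view apply. [cite: Balaban1985UV3, Thm 1 p.257, Thm 2 p.272; Balaban1989LargeFieldII, Thm 1 + (0.1) pp.355–356 (bookkeeping)] -/
theorem exists_world₁₃CSepCoP_view₁₃CoPB10YZW_b10_main_of_slot (θ : Stage13Params F N) (h : θ.Provisos₁₃SepCoP F N) (hθ : θ.Admissible F N) (Mstar : ℕ)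
    (ops : OpsY N θ.toStage3Params Mstar) (ζ : ResidZ F N) (lamW : ResidW F N) {γw : ℝ} (hγw : 0 < γw ∧ γw ≤ θ.γ) (hUV : PrintedUV3V N θ.L) :
    ∃ w : WorldP, IsRecordOfRecord₁₃CSepCoP F N (datumOfRecord₁₃SepCoP F N θ h) w ∧ w.γ = γw ∧ w.L = (θ.L : ℝ) ∧
      (∀ P, w.up P = upOfRecord₅C F N (θ.view₁₃CoPB10YZW F N Mstar ops ζ lamW) P) ∧ ∀ P : B12.RunParams, Dag.B10_main (leavesP w P) := by
  obtain ⟨w, hR, hγ, hL, hup⟩ := exists_world_isRecordOfRecord₁₃CSepCoP_view₁₃CoPB10YZW θ h hθ Mstar ops ζ lamW hγw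
  exact ⟨w, hR, hγ, hL, hup, b10_main_of_up_view₁₃CoPB10YZW θ Mstar ops ζ lamW hup hUV⟩

/-- **THE PINNED PRESENTATION** at the v1.5 record: from `θ`, its v1.5 provisos, admissibility and guard, and `PrintedUV3V N θ.L` — a presenting
parameter `θ' := θ.pinB10` with provisos `h'`, THE SAME datum (`datumOfRecord₁₃SepCoP_pinB10`), the guard and admissibility read AT `θ'` (carrier-blind), a world bound over
`θ'.toStage5₁₃CoP` that IS a ₁₃CSepCoP record and carries N08 at every run, AND THE PIN READ AT `θ'` (`θ'.L = θ.L`, `rfl`). [cite: Balaban1985UV3, Thm 1 p.257, Thm 2 p.272; Balaban1989LargeFieldII, Thm 1 + (0.1) pp.355–356; Balaban1988Convergent, (3.16)–(3.22) pp.268–269 (the guard; bookkeeping)] -/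
theorem exists_pinned_presentation₁₃CSepCoP_b10_main (θ : Stage13Params F N) (h : θ.Provisos₁₃SepCoP F N) (hθ : θ.Admissible F N)
    (hG : θ.ZtUnity F N ∧ θ.SlotsNondegenerate₁₃ F N) {γw : ℝ} (hγw : 0 < γw ∧ γw ≤ θ.γ) (hUV : PrintedUV3V N θ.L) :
    ∃ (θ' : Stage13Params F N) (h' : θ'.Provisos₁₃SepCoP F N) (w : WorldP), (θ'.ZtUnity F N ∧ θ'.SlotsNondegenerate₁₃ F N) ∧ θ'.Admissible F N ∧
      datumOfRecord₁₃SepCoP F N θ' h' = datumOfRecord₁₃SepCoP F N θ h ∧ w.C = (datumOfRecord₁₃SepCoP F N θ' h').C ∧ (0 < w.γ ∧ w.γ ≤ θ'.γ) ∧ w.γ = γw ∧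
      w.L = (θ'.L : ℝ) ∧ (∀ P, w.up P = upOfRecord₅C F N (θ'.toStage5₁₃CoP F N) P) ∧ IsRecordOfRecord₁₃CSepCoP F N (datumOfRecord₁₃SepCoP F N θ h) w ∧
      (∀ P : B12.RunParams, Dag.B10_main (leavesP w P)) ∧ PrintedUV3V N θ'.L := by
  obtain ⟨w, hR, hγ, hL, hup, hN⟩ := exists_world₁₃CSepCoP_b10_main_of_slot θ h hθ hγw hUV
  refine ⟨θ.pinB10 F N, h.pinB10, w, (N08AtRecord13.guard_pinB10_iff θ).2 hG, (Stage13Params.pinB10_admissible_iff F N θ).2 hθ,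
    datumOfRecord₁₃SepCoP_pinB10 F N θ h, ?_, ?_, hγ, hL, fun P => (hup P).trans (by rw [Stage13Params.toStage5₁₃CoP_pinB10]), hR, hN, hUV⟩
  · rw [datumOfRecord₁₃SepCoP_pinB10 F N θ h]; exact construction_eq_of_isRecordOfRecord₁₃CSepCoP hR
  · rw [hγ]; exact hγw

/-- **THE FOUR-PIN PRESENTATION** at the v1.5 record (package EXPOSED): presenting parameter `θ' := (((θ.pinB10).pinY (Y9OfRecord …)).pinZ (Z11OfRecord ζ)).pinW
(WOfRecord₁₃ θ lamW)` — THE SAME datum (the four `datumOfRecord₁₃SepCoP_pin<G>`), guard and admissibility read AT `θ'` (pin-blind), a world bound over `θ'.toStage5₁₃CoP`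
(= `θ.view₁₃CoPB10YZW …`, `view₁₃CoPB10YZW_eq`) that IS a ₁₃CSepCoP record of `datumOfRecord₁₃SepCoP θ h` and carries N08 at every run — from `PrintedUV3V N θ.L`, WITH THE PIN READ AT `θ'`.
[cite: Balaban1985UV3, Thm 1 p.257, Thm 2 p.272; Balaban1989LargeFieldII, Thm 1 + (0.1) pp.355–356; Balaban1988Convergent, (3.16)–(3.22) pp.268–269 (bookkeeping)] -/
theorem exists_pinned4_presentation₁₃CSepCoP_b10_main (θ : Stage13Params F N) (h : θ.Provisos₁₃SepCoP F N) (hθ : θ.Admissible F N)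
    (hG : θ.ZtUnity F N ∧ θ.SlotsNondegenerate₁₃ F N) (Mstar : ℕ) (ops : OpsY N θ.toStage3Params Mstar) (ζ : ResidZ F N) (lamW : ResidW F N) {γw : ℝ}
    (hγw : 0 < γw ∧ γw ≤ θ.γ) (hUV : PrintedUV3V N θ.L) :
    ∃ (θ' : Stage13Params F N) (h' : θ'.Provisos₁₃SepCoP F N) (w : WorldP), (θ'.ZtUnity F N ∧ θ'.SlotsNondegenerate₁₃ F N) ∧ θ'.Admissible F N ∧
      datumOfRecord₁₃SepCoP F N θ' h' = datumOfRecord₁₃SepCoP F N θ h ∧ w.C = (datumOfRecord₁₃SepCoP F N θ' h').C ∧ (0 < w.γ ∧ w.γ ≤ θ'.γ) ∧ w.γ = γw ∧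
      w.L = (θ'.L : ℝ) ∧ (∀ P, w.up P = upOfRecord₅C F N (θ'.toStage5₁₃CoP F N) P) ∧ (∀ P, w.up P = upOfRecord₅C F N (θ.view₁₃CoPB10YZW F N Mstar ops ζ lamW) P) ∧
      IsRecordOfRecord₁₃CSepCoP F N (datumOfRecord₁₃SepCoP F N θ h) w ∧ (∀ P : B12.RunParams, Dag.B10_main (leavesP w P)) ∧ PrintedUV3V N θ'.L := by
  obtain ⟨w, hR, hγ, hL, hup, hN⟩ := exists_world₁₃CSepCoP_view₁₃CoPB10YZW_b10_main_of_slot θ h hθ Mstar ops ζ lamW hγw hUV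
  have h₁ : (θ.pinB10 F N).Provisos₁₃SepCoP F N := h.pinB10
  have h₂ : ((θ.pinB10 F N).pinY F N (Y9OfRecord N θ.toStage3Params Mstar ops)).Provisos₁₃SepCoP F N := h₁.pinY _
  have h₃ : (((θ.pinB10 F N).pinY F N (Y9OfRecord N θ.toStage3Params Mstar ops)).pinZ F N (Z11OfRecord F N ζ)).Provisos₁₃SepCoP F N := h₂.pinZ _
  have h₄ : ((((θ.pinB10 F N).pinY F N (Y9OfRecord N θ.toStage3Params Mstar ops)).pinZ F N (Z11OfRecord F N ζ)).pinW F N (WOfRecord₁₃ F N θ lamW)).Provisos₁₃SepCoP F N :=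
    h₃.pinW _
  have hD : datumOfRecord₁₃SepCoP F N _ h₄ = datumOfRecord₁₃SepCoP F N θ h := by
    rw [datumOfRecord₁₃SepCoP_pinW F N _ h₃, datumOfRecord₁₃SepCoP_pinZ F N _ h₂, datumOfRecord₁₃SepCoP_pinY F N _ h₁, datumOfRecord₁₃SepCoP_pinB10 F N θ h]
  refine ⟨_, h₄, w,
    (N08AtRecord13.guard_pinW_iff _ _).2 ((N08AtRecord13.guard_pinZ_iff _ _).2 ((N08AtRecord13.guard_pinY_iff _ _).2 ((N08AtRecord13.guard_pinB10_iff θ).2 hG))),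
    (Stage13Params.pinW_admissible_iff F N _ _).2 ((Stage13Params.pinZ_admissible_iff F N _ _).2
      ((Stage13Params.pinY_admissible_iff F N _ _).2 ((Stage13Params.pinB10_admissible_iff F N _).2 hθ))),
    hD, ?_, ?_, hγ, hL, fun P => (hup P).trans (by rw [Stage13Params.view₁₃CoPB10YZW_eq]), hup, hR, hN, hUV⟩
  · rw [hD]; exact construction_eq_of_isRecordOfRecord₁₃CSepCoP hR
  · rw [hγ]; exact hγw

/-- **«THE K0 ANTECEDENT (v1.5 key) ⟹ N08's CONJUNCT OF RUNG 1, WITH ITS PIN»**, generic `N`: from `∃ θ, Provisos₁₃SepCoP ∧ (ZtUnity ∧ SlotsNondegenerate₁₃) ∧ Admissible` at `F`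
(HYPOTHESIS `hI`, the guard bundled as ONE conjunct and carried to the SAME `θ` untouched) and the slot of record at every odd `L > 1` (HYPOTHESIS `hUV`, the node's object
gap), SOME guarded admissible tuple `θ`, v1.5 provisos `h` and world `w` with `IsRecordOfRecord₁₃CSepCoP F N (datumOfRecord₁₃SepCoP F N θ h) w`, `Dag.B10_main` at every
run (`γw := θ.γ`), AND `PrintedUV3V N θ.L` (plan's rung-1 pin, read at this `θ`).  NOT the stub (twelve conjuncts missing), NOT a discharge. [cite: Balaban1985UV3, Thm 1 p.257, Thm 2 p.272; Balaban1989LargeFieldII, Thm 1 + (0.1) pp.355–356; Balaban1988Convergent, (3.16)–(3.22) pp.268–269 (bookkeeping)] -/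
theorem exists_guarded_record₁₃CSepCoP_b10_main_of_inhabited13SepCoP
    (hI : ∃ θ : Stage13Params F N, θ.Provisos₁₃SepCoP F N ∧ (θ.ZtUnity F N ∧ θ.SlotsNondegenerate₁₃ F N) ∧ θ.Admissible F N)
    (hUV : ∀ L : ℕ, Odd L → 1 < L → PrintedUV3V N L) :
    ∃ (θ : Stage13Params F N) (h : θ.Provisos₁₃SepCoP F N) (w : WorldP), (θ.ZtUnity F N ∧ θ.SlotsNondegenerate₁₃ F N) ∧ θ.Admissible F N ∧
      IsRecordOfRecord₁₃CSepCoP F N (datumOfRecord₁₃SepCoP F N θ h) w ∧ (∀ P : B12.RunParams, Dag.B10_main (leavesP w P)) ∧ PrintedUV3V N θ.L := by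
  obtain ⟨θ, h, hG, hθ⟩ := hI
  have hUVθ : PrintedUV3V N θ.L := hUV θ.L θ.hL.1 θ.hL.2
  obtain ⟨w, hR, -, -, -, hN⟩ := exists_world₁₃CSepCoP_b10_main_of_slot θ h hθ ⟨hθ.toStage9.gamma_pos, le_rfl⟩ hUVθ
  exact ⟨θ, h, w, hG, hθ, hR, hN, hUVθ⟩

/-- **THE SAME AT THE GROUP OF RECORD `N = 2`, hypothesis = the rev-20 K0 text** (plan's rev-18 `Record13SepInhabited` body at `F` under KEY-21T `Provisos₁₃Sep ↦ Provisos₁₃SepCoP`, director-ym №142 (S3):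
`∃ θ : Stage13Params F 2, θ.Provisos₁₃SepCoP F 2 ∧ (θ.ZtUnity F 2 ∧ θ.SlotsNondegenerate₁₃ F 2) ∧ θ.Admissible F 2`): N08's conjunct of rung 1 `NodesAtSomeRecord13P`
from it and the slot at every odd `L > 1`, with the pin `PrintedUV3V 2 θ.L`.  NOT the stub, NOT a discharge. [cite: Balaban1985UV3, Thm 1 p.257, Thm 2 p.272; Balaban1989LargeFieldII, Thm 1 + (0.1) pp.355–356 (bookkeeping)] -/
theorem exists_guarded_record₁₃CSepCoP_b10_main_of_inhabited13SepCoP_two (F : T4Family)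
    (hI : ∃ θ : Stage13Params F 2, θ.Provisos₁₃SepCoP F 2 ∧ (θ.ZtUnity F 2 ∧ θ.SlotsNondegenerate₁₃ F 2) ∧ θ.Admissible F 2)
    (hUV : ∀ L : ℕ, Odd L → 1 < L → PrintedUV3V 2 L) :
    ∃ (θ : Stage13Params F 2) (h : θ.Provisos₁₃SepCoP F 2) (w : WorldP), (θ.ZtUnity F 2 ∧ θ.SlotsNondegenerate₁₃ F 2) ∧ θ.Admissible F 2 ∧
      IsRecordOfRecord₁₃CSepCoP F 2 (datumOfRecord₁₃SepCoP F 2 θ h) w ∧ (∀ P : B12.RunParams, Dag.B10_main (leavesP w P)) ∧ PrintedUV3V 2 θ.L :=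
  exists_guarded_record₁₃CSepCoP_b10_main_of_inhabited13SepCoP hI hUV

end Currency

/-! ## §3 ON THE STAGE-13 WITNESS LINE OF RECORD `θ₁₃ = theta13LiveOfRecord F N` (block size `F.L`, window `γ = 1∕2`) — N08's share costs `PrintedUV3V N F.L`; the guard
is K0a's HYPOTHESIS-FREE row P12 (`Record13LiveSelectorFamily` v1.1) -/

section WitnessLine
variable (F N)

/-- **N08's SHARE OF THE rev-20 NODES STUB ON THE WITNESS LINE OF RECORD COSTS THE SINGLE PROP `PrintedUV3V N F.L`** (plus K0's own v1.5 provisos `hP` at `θ₁₃`,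
HYPOTHESIS; admissibility is K0a's THEOREM `admissible_theta13LiveOfRecord`): a world of `datumOfRecord₁₃SepCoP F N θ₁₃ hP` (`w.γ = 1∕2`, `w.L = F.L`), bound over the
[B10]-pinned view of `θ₁₃`, that is a ₁₃CSepCoP record and carries N08 at every run.  At `N = 2`: [Balaban1985UV3] Thm 1-compact ∧ Thm 2 with their printed ∃-prefix for SU(2)
at the family's block size `F.L`, at some version of print's transformations. [cite: Balaban1985UV3, Thm 1 p.257, Thm 2 p.272; Balaban1989LargeFieldII, Thm 1 + (0.1) pp.355–356; Balaban1987RG1, (0.21) p.256 (bookkeeping)] -/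
theorem exists_world₁₃CSepCoP_b10_main_at_theta13LiveOfRecord (hP : (theta13LiveOfRecord F N).Provisos₁₃SepCoP F N) (hUV : PrintedUV3V N F.L) :
    ∃ w : WorldP, IsRecordOfRecord₁₃CSepCoP F N (datumOfRecord₁₃SepCoP F N (theta13LiveOfRecord F N) hP) w ∧ w.γ = 1 / 2 ∧ w.L = (F.L : ℝ) ∧
      (∀ P, w.up P = upOfRecord₅C F N (((theta13LiveOfRecord F N).pinB10 F N).toStage5₁₃CoP F N) P) ∧
      ∀ P : B12.RunParams, Dag.B10_main (leavesP w P) :=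
  exists_world₁₃CSepCoP_b10_main_of_slot (theta13LiveOfRecord F N) hP (admissible_theta13LiveOfRecord F N) (γw := 1 / 2)
    ⟨one_half_pos, (N08AtRecord13.theta13LiveOfRecord_γ F N).symm.le⟩ hUV

/-- **N08's CONJUNCT OF RUNG 1, WITNESSED AT `θ₁₃` OF RECORD, `N = 2`, WITH ITS PIN** — from K0's open rows at the witness (`hP : θ₁₃.Provisos₁₃SepCoP F 2`, HYPOTHESIS)
and `PrintedUV3V 2 F.L`: the guard is K0a's HYPOTHESIS-FREE `ztUnity_theta13LiveOfRecord` ∕ `slotsNondegenerate₁₃_theta13LiveOfRecord_of_hasResiduals` and admissibility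
its `admissible_theta13LiveOfRecord`, BY NAME (no proviso row read).  NOT the stub, NOT a discharge. [cite: Balaban1985UV3, Thm 1 p.257, Thm 2 p.272; Balaban1988Convergent, Thm 1 p.262, (3.16)–(3.22) pp.268–269; Balaban1989LargeFieldI, (0.3)–(0.4) p.176 (bookkeeping)] -/
theorem exists_guarded_record₁₃CSepCoP_b10_main_of_theta13Live_provisosSepCoP_two (F : T4Family) (hP : (theta13LiveOfRecord F 2).Provisos₁₃SepCoP F 2)
    (hUV : PrintedUV3V 2 F.L) :
    ∃ (θ : Stage13Params F 2) (h : θ.Provisos₁₃SepCoP F 2) (w : WorldP), (θ.ZtUnity F 2 ∧ θ.SlotsNondegenerate₁₃ F 2) ∧ θ.Admissible F 2 ∧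
      IsRecordOfRecord₁₃CSepCoP F 2 (datumOfRecord₁₃SepCoP F 2 θ h) w ∧ (∀ P : B12.RunParams, Dag.B10_main (leavesP w P)) ∧ PrintedUV3V 2 θ.L := by
  obtain ⟨w, hR, -, -, -, hN⟩ := exists_world₁₃CSepCoP_b10_main_at_theta13LiveOfRecord F 2 hP hUV
  exact ⟨_, hP, w, ⟨ztUnity_theta13LiveOfRecord F 2, slotsNondegenerate₁₃_theta13LiveOfRecord_of_hasResiduals F 2⟩,
    admissible_theta13LiveOfRecord F 2, hR, hN, hUV⟩

end WitnessLine

/-! ## §4 AT K0a's STAGE-13 WITNESS FAMILIES — the all-numerics family `θ₁₃(n, ε₂₉)` (`γ = n.γ`) and the two-letter family `θ₁₃(ε₀, ε₂₉)` (`γ = 1∕2`), block size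
`F.L`; v1.5 provisos OPAQUE, guard HYPOTHESIS-FREE -/

section Numerics
variable (F : T4Family) (N : ℕ) [NeZero N] {n : Stage12Numerics} {ε₂₉ : ℝ}

/-- **N08's SHARE OF THE rev-20 NODES STUB AT ANY MEMBER `θ₁₃(n, ε₂₉)` COSTS THE SINGLE PROP `PrintedUV3V N F.L`** (plus the member's v1.5 provisos `hP`, HYPOTHESIS, and
the two displayed signs `n.Pos`, `0 < ε₂₉` under which K0a's `admissible_theta13LiveOfNumerics` gives admissibility): a world of the member's v1.5 datum (`w.γ = n.γ`,
`w.L = F.L`), bound over the [B10]-pinned Stage-13 view of the member, that IS a ₁₃CSepCoP record and carries N08 at every run (§2 `exists_world₁₃CSepCoP_b10_main_of_slot`).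
[cite: Balaban1985UV3, Thm 1 p.257, Thm 2 p.272; Balaban1989LargeFieldII, Thm 1 + (0.1) pp.355–356; Balaban1987RG1, (0.21) p.256, (2.9) p.266 (bookkeeping)] -/
theorem exists_world₁₃CSepCoP_b10_main_at_theta13LiveOfNumerics (hn : n.Pos) (hε' : 0 < ε₂₉)
    (hP : (theta13LiveOfNumerics F N n ε₂₉ (zeta316OfRecord F N n.ν n.τ9.M n.A₁) (RzOfRecord F N) (ZtOfRecord F N)).Provisos₁₃SepCoP F N)
    (hUV : PrintedUV3V N F.L) :
    ∃ w : WorldP,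
      IsRecordOfRecord₁₃CSepCoP F N
          (datumOfRecord₁₃SepCoP F N (theta13LiveOfNumerics F N n ε₂₉ (zeta316OfRecord F N n.ν n.τ9.M n.A₁) (RzOfRecord F N) (ZtOfRecord F N)) hP) w ∧
        w.γ = n.γ ∧ w.L = (F.L : ℝ) ∧
        (∀ P, w.up P = upOfRecord₅C F N
          (((theta13LiveOfNumerics F N n ε₂₉ (zeta316OfRecord F N n.ν n.τ9.M n.A₁) (RzOfRecord F N) (ZtOfRecord F N)).pinB10 F N).toStage5₁₃CoP F N) P) ∧
        ∀ P : B12.RunParams, Dag.B10_main (leavesP w P) :=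
  have hθ := admissible_theta13LiveOfNumerics F N (zeta316OfRecord F N n.ν n.τ9.M n.A₁) (RzOfRecord F N) (ZtOfRecord F N) hn hε'
  exists_world₁₃CSepCoP_b10_main_of_slot _ hP hθ (γw := n.γ) ⟨hθ.toStage9.gamma_pos, le_rfl⟩ hUV

/-- **N08's CONJUNCT OF RUNG 1, WITNESSED AT THE MEMBER `θL F n ε₂₉`, `N = 2`, WITH ITS PIN** — from the member's v1.5 provisos (`hP`, HYPOTHESIS), the signs
`n.Pos`, `0 < ε₂₉`, and `PrintedUV3V 2 F.L`: the guard is K0a's HYPOTHESIS-FREE `ztUnity_theta13LiveOfNumerics` ∕ `slotsNondegenerate₁₃_theta13LiveOfNumerics_of_hasResiduals`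
and admissibility its `admissible_theta13LiveOfNumerics`, BY NAME.  NOT the stub, NOT a discharge. [cite: Balaban1985UV3, Thm 1 p.257, Thm 2 p.272; Balaban1988Convergent, Thm 1 p.262, (3.16)–(3.22) pp.268–269; Balaban1989LargeFieldI, (0.3)–(0.4) p.176 (bookkeeping)] -/
theorem exists_guarded_record₁₃CSepCoP_b10_main_of_theta13Numerics_provisosSepCoP_two (F : T4Family) {n : Stage12Numerics} {ε₂₉ : ℝ} (hn : n.Pos)
    (hε' : 0 < ε₂₉)
    (hP : (theta13LiveOfNumerics F 2 n ε₂₉ (zeta316OfRecord F 2 n.ν n.τ9.M n.A₁) (RzOfRecord F 2) (ZtOfRecord F 2)).Provisos₁₃SepCoP F 2)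
    (hUV : PrintedUV3V 2 F.L) :
    ∃ (θ : Stage13Params F 2) (h : θ.Provisos₁₃SepCoP F 2) (w : WorldP), (θ.ZtUnity F 2 ∧ θ.SlotsNondegenerate₁₃ F 2) ∧ θ.Admissible F 2 ∧
      IsRecordOfRecord₁₃CSepCoP F 2 (datumOfRecord₁₃SepCoP F 2 θ h) w ∧ (∀ P : B12.RunParams, Dag.B10_main (leavesP w P)) ∧ PrintedUV3V 2 θ.L := by
  obtain ⟨w, hR, -, -, -, hN⟩ := exists_world₁₃CSepCoP_b10_main_at_theta13LiveOfNumerics F 2 hn hε' hP hUV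
  exact ⟨_, hP, w, ⟨ztUnity_theta13LiveOfNumerics F 2 n ε₂₉, slotsNondegenerate₁₃_theta13LiveOfNumerics_of_hasResiduals F 2 n ε₂₉⟩,
    admissible_theta13LiveOfNumerics F 2 _ _ _ hn hε', hR, hN, hUV⟩

end Numerics

section Family₂
variable (F : T4Family) (N : ℕ) [NeZero N] {ε₀ ε₂₉ : ℝ}

/-- **N08's SHARE AT ANY MEMBER `θ₁₃(ε₀, ε₂₉)` OF THE TWO-LETTER FAMILY COSTS `PrintedUV3V N F.L`** (plus the member's v1.5 provisos `hP` and the signs `0 < ε₀`,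
`0 < ε₂₉`; admissibility is K0a's `admissible_theta13LiveOfFamily₂`): a world of the member's v1.5 datum (`w.γ = 1∕2`, `w.L = F.L`) bound over the [B10]-pinned CoP view,
a ₁₃CSepCoP record carrying N08 at every run. [cite: Balaban1985UV3, Thm 1 p.257, Thm 2 p.272; Balaban1989LargeFieldII, Thm 1 + (0.1) pp.355–356; Balaban1987RG1, (1.2) p.260, (2.9) p.266 (bookkeeping)] -/
theorem exists_world₁₃CSepCoP_b10_main_at_theta13LiveOfFamily₂ (hε : 0 < ε₀) (hε' : 0 < ε₂₉)
    (hP : (theta13LiveOfFamily₂ F N ε₀ ε₂₉ (zeta316OfRecord F N (numerics7OfFamily ε₀) 1 1) (RzOfRecord F N) (ZtOfRecord F N)).Provisos₁₃SepCoP F N)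
    (hUV : PrintedUV3V N F.L) :
    ∃ w : WorldP,
      IsRecordOfRecord₁₃CSepCoP F N
          (datumOfRecord₁₃SepCoP F N (theta13LiveOfFamily₂ F N ε₀ ε₂₉ (zeta316OfRecord F N (numerics7OfFamily ε₀) 1 1) (RzOfRecord F N) (ZtOfRecord F N)) hP) w ∧
        w.γ = 1 / 2 ∧ w.L = (F.L : ℝ) ∧
        (∀ P, w.up P = upOfRecord₅C F N
          (((theta13LiveOfFamily₂ F N ε₀ ε₂₉ (zeta316OfRecord F N (numerics7OfFamily ε₀) 1 1) (RzOfRecord F N) (ZtOfRecord F N)).pinB10 F N).toStage5₁₃CoP F N) P) ∧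
        ∀ P : B12.RunParams, Dag.B10_main (leavesP w P) :=
  exists_world₁₃CSepCoP_b10_main_of_slot _ hP (admissible_theta13LiveOfFamily₂ F N _ _ _ hε hε') (γw := 1 / 2)
    ⟨one_half_pos, (theta13LiveOfFamily₂_γ F N ε₀ ε₂₉ _ _ _).symm.le⟩ hUV

/-- **N08's CONJUNCT OF RUNG 1, WITNESSED AT THE MEMBER `θ₁₃(ε₀, ε₂₉)`, `N = 2`, WITH ITS PIN** — from the member's v1.5 provisos (`hP`, HYPOTHESIS), `0 < ε₀`,
`0 < ε₂₉` and `PrintedUV3V 2 F.L`; the guard is K0a's HYPOTHESIS-FREE `ztUnity_theta13LiveOfFamily₂` ∕ `slotsNondegenerate₁₃_theta13LiveOfFamily₂_of_hasResiduals`, admissibility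
its `admissible_theta13LiveOfFamily₂`, BY NAME.  NOT the stub, NOT a discharge. [cite: Balaban1985UV3, Thm 1 p.257, Thm 2 p.272; Balaban1988Convergent, Thm 1 p.262, (3.16)–(3.22) pp.268–269; Balaban1989LargeFieldI, (0.3)–(0.4) p.176 (bookkeeping)] -/
theorem exists_guarded_record₁₃CSepCoP_b10_main_of_theta13Family₂_provisosSepCoP_two (F : T4Family) {ε₀ ε₂₉ : ℝ} (hε : 0 < ε₀) (hε' : 0 < ε₂₉)
    (hP : (theta13LiveOfFamily₂ F 2 ε₀ ε₂₉ (zeta316OfRecord F 2 (numerics7OfFamily ε₀) 1 1) (RzOfRecord F 2) (ZtOfRecord F 2)).Provisos₁₃SepCoP F 2)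
    (hUV : PrintedUV3V 2 F.L) :
    ∃ (θ : Stage13Params F 2) (h : θ.Provisos₁₃SepCoP F 2) (w : WorldP), (θ.ZtUnity F 2 ∧ θ.SlotsNondegenerate₁₃ F 2) ∧ θ.Admissible F 2 ∧
      IsRecordOfRecord₁₃CSepCoP F 2 (datumOfRecord₁₃SepCoP F 2 θ h) w ∧ (∀ P : B12.RunParams, Dag.B10_main (leavesP w P)) ∧ PrintedUV3V 2 θ.L := by
  obtain ⟨w, hR, -, -, -, hN⟩ := exists_world₁₃CSepCoP_b10_main_at_theta13LiveOfFamily₂ F 2 hε hε' hP hUV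
  exact ⟨_, hP, w, ⟨ztUnity_theta13LiveOfFamily₂ F 2 ε₀ ε₂₉, slotsNondegenerate₁₃_theta13LiveOfFamily₂_of_hasResiduals F 2 ε₀ ε₂₉⟩,
    admissible_theta13LiveOfFamily₂ F 2 _ _ _ hε hε', hR, hN, hUV⟩

end Family₂

end Summit.QuantumFields.YangMills.BalabanUVNodes.N08AtRecord13SepCoP

end
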